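import Literature.NumberTheory.EllipticCurves.TwoDescentKummerBridge
import Literature.NumberTheory.EllipticCurves.LocalKummerMap
import Literature.NumberTheory.GaloisRepresentations.ContinuousCohomologyConnecting
import Literature.NumberTheory.GaloisRepresentations.KummerRestriction
import HarnessLib

/-!
# The descent–Kummer bridge at a completion: the local Kummer image is the descent image

For an elliptic curve `E/K` (`char K = 0`) with rational `2`-torsion `e₁, e₂, e₃` and a `K`-field
`E` (a completion `K_v`), the tree's `2`-Selmer group `Sel⁽²⁾(E/K) ⊆ H¹(K, E[2])` is cut out by the
local Kummer conditions `𝓛_E = kummerLocalConditionAt W 2 E ⊆ H¹(Γ_E, E[2](K̄)|_{Γ_E})`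
(`KummerSelmerStructure.lean`: `comap_res_kummerLocalConditionAt`), and `𝓛_E` is the image of the
local Kummer map `(W⁄E)(E)/2 → H¹` (`LocalKummerMap.lean`: `range_localKummerMap`), which is the
Kummer map of the base-changed curve `W⁄E` transported along `E[2](K̄) ≃ (W⁄E)[2](Ē)`
(`localKummerMap_eq_cohomologyMap_kummerMapTorsion`). This file reads all of that through the
`T₁`-character of `TwoDescentTwoTorsionCharacter.lean` and Kummer theory, using the bridge
`kummerEquiv ∘ H¹(χ₁) ∘ κ = twoDescentComponent` of `TwoDescentKummerBridge.lean` for `W⁄E` and the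
naturality of Kummer theory for restriction (`KummerRestriction.lean`):

* `resTwoTorsionChar W E h : E[2](K̄) →+ μ₂(Ē)` — `χ₁` read in `Ē` (`Γ_E`-equivariant), and the
  induced `resTwoTorsionCharH1 : H¹(Γ_E, E[2](K̄)|_{Γ_E}) →+ H¹(E, μ₂(Ē))`;
* `resTwoTorsionCharH1_res`: **naturality** `H¹(χ₁|_E)(res c) = resMu (H¹(χ₁) c)`;
* `torsionTransferEquiv_geomTwoTorsion` (`T₁ ↦ T₁` across `K̄ → Ē`),
  `resTwoTorsionChar_torsionTransferEquiv_symm` and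
  `resTwoTorsionCharH1_cohomologyMap_torsionTransferInvHom`: **the restricted character of `W` is
  the character of `W⁄E`** across the torsion transfer;
* `exists_kummerEquiv_resTwoTorsionCharH1_eq_of_mem_kummerLocalConditionAt`: **the local Kummer
  image is the descent image** — every `c ∈ 𝓛_E` has `T₁`-component in `Eˣ/Eˣ²` equal to
  `twoDescentComponent (W⁄E) P` for some `P ∈ (W⁄E)(E)`;
* `exists_kummerEquiv_resMu_twoTorsionCharH1_eq_of_res_mem`, `exists_twoDescentComponent_eq_of_res_mem`:
  **the localised global component**: for `c ∈ H¹(K, E[2])` with `res_E c ∈ 𝓛_E` (e.g.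
  `c ∈ Sel⁽²⁾(E/K)` at `E = K_v`), if `kummerEquiv K 2 (H¹(χ₁) c) = [a]`, `a ∈ Kˣ`, then the class of
  `a` in `Eˣ/Eˣ²` is the descent component `x(P) - e₁` of a point `P ∈ E(E)`.

Hence a Selmer class, written through the injection `(H¹(χ₁), H¹(χ₂)) : H¹(K, E[2]) ↪ (Kˣ/Kˣ²)²`
(`eq_zero_of_twoTorsionCharH1_eq_zero`), has at every completion a pair of square classes in the
image of the classical complete `2`-descent map of `E(K_v)` — the local half of the identification
`Sel⁽²⁾(E/K) = {(a, b) ∈ K(S,2)² : (a, b) ∈ δ(E(K_v)) ∀ v}` (Silverman AEC Prop. X.1.4 and X.4.9); the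
global half (unramified classes, `K(S, 2)`) is left to a sequel. Definitions with bodies and theorems
only; no named fact. Cell `bsd-monsky` (towards `#Sel⁽²⁾(E_{2pq}) ≤ 8` as a kernel theorem).

## References

* [SilvermanAEC2009] J. H. Silverman, *The Arithmetic of Elliptic Curves*, 2nd ed., GTM 106,
  Springer 2009, Thm. X.1.1, Prop. X.1.4, X.§4 (diagram (**) before Thm. X.4.2, Prop. X.4.9).
* [SerreGaloisCohomology1997] J.-P. Serre, *Galois Cohomology*, Springer 1997, I §2.4, II §1.2.
-/

noncomputable section

open scoped Classical

open Field

universe u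



namespace WeierstrassCurve

open Literature.NumberTheory.GaloisRepresentations Literature.NumberTheory.EllipticCurves Field
open WeierstrassCurve.Affine DiscreteGaloisModule

variable {K : Type u} [Field K] [CharZero K] (W : WeierstrassCurve K) [W.IsElliptic] {e₁ e₂ e₃ : K}
variable (E : Type u) [Field E] [Algebra K E]

/-! ### The restricted character `E[2](K̄)|_{Γ_E} → μ₂(Ē)` -/

/-- The character `χ₁` of `T₁`, restricted to `Γ_E` and read in `μ₂(Ē)` along the chosen embedding
`K̄ → Ē`: `T ↦ ι(χ₁ T)`. [cite: SilvermanAEC2009, Thm. X.1.1] -/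
def resTwoTorsionChar (h : W.toAffine.SplitTwoTorsion e₁ e₂ e₃) :
    geomTorsion W 2 →+ MuCarrier E 2 :=
  (muTransfer K E 2).comp (W.twoTorsionChar h)

/-- Unfolding `resTwoTorsionChar`. [cite: SilvermanAEC2009, Thm. X.1.1] -/
theorem resTwoTorsionChar_apply (h : W.toAffine.SplitTwoTorsion e₁ e₂ e₃) (T : geomTorsion W 2) :
    W.resTwoTorsionChar E h T = muTransfer K E 2 (W.twoTorsionChar h T) :=
  rfl

/-- `resTwoTorsionChar` is `Γ_E`-equivariant (`Γ_E` acting on `E[2](K̄)` through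
`absGaloisRestrict K E`). [cite: SerreGaloisCohomology1997, I §2.4] -/
theorem resTwoTorsionChar_smul (h : W.toAffine.SplitTwoTorsion e₁ e₂ e₃) (σ : absoluteGaloisGroup E)
    (T : geomTorsion W 2) :
    W.resTwoTorsionChar E h (absGaloisRestrict K E σ • T) = mu E 2 σ (W.resTwoTorsionChar E h T) := by
  rw [resTwoTorsionChar_apply, resTwoTorsionChar_apply, twoTorsionChar_smul, muTransfer_mu]

/-- The restricted character as a morphism of `Γ_E`-modules
`E[2](K̄)|_{Γ_E} → μ₂(Ē)` in `TopRep ℤ Γ_E`. [cite: SerreGaloisCohomology1997, I §2.4] -/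
def resTwoTorsionCharHom (h : W.toAffine.SplitTwoTorsion e₁ e₂ e₃) :
    DiscreteGaloisModule.toTopRep (GaloisRep.restrictField E (W.torsionGaloisModule 2)) ⟶
      (mu E 2).toTopRep :=
  TopRep.ofHom
    { toLinearMap := (W.resTwoTorsionChar E h).toIntLinearMap
      cont := continuous_of_discreteTopology
      isIntertwining' := fun σ ↦ by
        ext T
        exact W.resTwoTorsionChar_smul E h σ T }

/-- Values of `resTwoTorsionCharHom`. [cite: SerreGaloisCohomology1997, I §2.4] -/
@[simp]
theorem resTwoTorsionCharHom_hom_apply (h : W.toAffine.SplitTwoTorsion e₁ e₂ e₃)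
    (T : geomTorsion W 2) : (W.resTwoTorsionCharHom E h).hom T = W.resTwoTorsionChar E h T :=
  rfl

/-- **`H¹(Γ_E, E[2](K̄)|_{Γ_E}) →+ H¹(E, μ₂(Ē))`**, induced by the restricted character.
[cite: SerreGaloisCohomology1997, I §2.4] -/
def resTwoTorsionCharH1 (h : W.toAffine.SplitTwoTorsion e₁ e₂ e₃) :
    galoisCohomology (GaloisRep.restrictField E (W.torsionGaloisModule 2)) 1 →+
      galoisCohomology (mu E 2) 1 :=
  (cohomologyMap (W.resTwoTorsionCharHom E h) 1).hom.toLinearMap.toAddMonoidHom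

/-- `resTwoTorsionCharH1` on explicit cocycles. [cite: SerreGaloisCohomology1997, I §2.4] -/
theorem resTwoTorsionCharH1_oneCocycleClass (h : W.toAffine.SplitTwoTorsion e₁ e₂ e₃)
    (ψ : contOneCocycles (DiscreteGaloisModule.toTopRep
      (GaloisRep.restrictField E (W.torsionGaloisModule 2)))) :
    W.resTwoTorsionCharH1 E h (oneCocycleClass _ ψ) =
      oneCocycleClass _ (contOneCocycles.pullback (ContinuousMonoidHom.id (absoluteGaloisGroup E))
        (resIdHom (W.resTwoTorsionCharHom E h)) ψ) :=
  cohomologyMap_oneCocycleClass _ ψ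

/-! ### Naturality: restricting the global component -/

/-- **Naturality of the `T₁`-component for restriction**:
`H¹(χ₁|_E)(res c) = resMu (H¹(χ₁) c)` for every `c ∈ H¹(K, E[2])` (both are the class of
`σ ↦ ι(χ₁(φ(σ|_{K̄})))`). [cite: SerreGaloisCohomology1997, I §2.4] -/
theorem resTwoTorsionCharH1_res (h : W.toAffine.SplitTwoTorsion e₁ e₂ e₃) (c : galH1Torsion W 2) :
    W.resTwoTorsionCharH1 E h (galoisCohomology.res (W.torsionGaloisModule 2) E 1 c) =
      resMu K E 2 (W.twoTorsionCharH1 h c) := by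
  obtain ⟨φ, rfl⟩ := oneCocycleClass_surjective _ c
  rw [res_torsionGaloisModule_oneCocycleClass, resTwoTorsionCharH1_oneCocycleClass,
    twoTorsionCharH1_oneCocycleClass, resMu_oneCocycleClass]
  congr 1


/-! ### Transport along `E[2](K̄) ≃ (W⁄E)[2](Ē)`: the characters of `W` and of `W⁄E` agree -/

variable [CharZero E]

/-- **`T₁` transfers to `T₁`**: under `torsionTransferEquiv : E[2](K̄) ≃ (W⁄E)[2](Ē)` (the identity on
coordinates across `K̄ → Ē`), the `2`-torsion point `T₁ = (e₁, *)` of `W` goes to the point `T₁` of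
`W⁄E`. [cite: SilvermanAEC2009, Prop. X.1.4] -/
theorem torsionTransferEquiv_geomTwoTorsion (h : W.toAffine.SplitTwoTorsion e₁ e₂ e₃)
    [(W.baseChange E).IsElliptic] :
    W.torsionTransferEquiv (E := E) (two_ne_zero : (2 : ℤ) ≠ 0) ⟨W.geomTwoTorsion h, W.geomTwoTorsion_mem h⟩ =
      ⟨(W.baseChange E).geomTwoTorsion (h.map E), (W.baseChange E).geomTwoTorsion_mem (h.map E)⟩ := by
  apply Subtype.ext
  rw [coe_torsionTransferEquiv_apply, AddEquiv.symm_apply_eq]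
  unfold geomTwoTorsion
  rw [baseChangeGeomPointsEquiv_some]
  show Affine.Point.map (W' := W) (closureEmb (K := K) E) (Affine.Point.some _ _ _) = _
  rw [Affine.Point.map_some]
  simp only [Affine.Point.some.injEq]
  constructor
  · rw [AlgHom.commutes, IsScalarTower.algebraMap_apply K E (AlgebraicClosure E)]
  · simp only [twoTorsionY, baseChange, map_a₁, map_a₃, map_neg, map_div₀, map_add, map_mul,
      map_ofNat, AlgHom.commutes, ← IsScalarTower.algebraMap_apply K E (AlgebraicClosure E)]

/-- **The restricted character of `W` is the character of `W⁄E`** across the torsion transfer: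
`ι(χ₁(A⁻¹ S)) = χ₁^{W⁄E}(S)` for `S ∈ (W⁄E)[2](Ē)` (both are `1` on `{O, T₁}` and `-1` otherwise,
and `A = torsionTransferEquiv` preserves `O` and `T₁`). [cite: SilvermanAEC2009, Thm. X.1.1] -/
theorem resTwoTorsionChar_torsionTransferEquiv_symm (h : W.toAffine.SplitTwoTorsion e₁ e₂ e₃)
    [(W.baseChange E).IsElliptic] (S : geomTorsion (W.baseChange E) 2) :
    W.resTwoTorsionChar E h ((W.torsionTransferEquiv (E := E) (two_ne_zero : (2 : ℤ) ≠ 0)).symm S) =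
      (W.baseChange E).twoTorsionChar (h.map E) S := by
  set A := W.torsionTransferEquiv (E := E) (two_ne_zero : (2 : ℤ) ≠ 0)
  have hT := W.torsionTransferEquiv_geomTwoTorsion E h
  apply muVal_injective E 2
  rw [resTwoTorsionChar_apply, muVal_muTransfer, twoTorsionChar_apply, twoTorsionChar_apply,
    muVal_twoTorsionCharFun, muVal_twoTorsionCharFun]
  have h0 : ((A.symm S : geomTorsion W 2) : geomPoints W) = 0 ↔
      ((S : geomTorsion (W.baseChange E) 2) : geomPoints (W.baseChange E)) = 0 := by
    rw [← AddSubgroup.coe_zero, Subtype.coe_inj, ← AddSubgroup.coe_zero (H := geomTorsion (W.baseChange E) 2),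
      Subtype.coe_inj, AddEquiv.map_eq_zero_iff]
  have h1 : ((A.symm S : geomTorsion W 2) : geomPoints W) = W.geomTwoTorsion h ↔
      ((S : geomTorsion (W.baseChange E) 2) : geomPoints (W.baseChange E)) =
        (W.baseChange E).geomTwoTorsion (h.map E) := by
    constructor
    · intro hS
      have : A.symm S = ⟨W.geomTwoTorsion h, W.geomTwoTorsion_mem h⟩ := Subtype.ext hS
      rw [AddEquiv.symm_apply_eq, hT] at this
      rw [this]
    · intro hS
      have : S = ⟨(W.baseChange E).geomTwoTorsion (h.map E), (W.baseChange E).geomTwoTorsion_mem (h.map E)⟩ :=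
        Subtype.ext hS
      rw [this, ← hT, AddEquiv.symm_apply_apply]
  by_cases hc : ((S : geomTorsion (W.baseChange E) 2) : geomPoints (W.baseChange E)) = 0 ∨
      ((S : geomTorsion (W.baseChange E) 2) : geomPoints (W.baseChange E)) =
        (W.baseChange E).geomTwoTorsion (h.map E)
  · rw [if_pos hc, if_pos ((or_congr h0 h1).mpr hc), map_one]
  · rw [if_neg hc, if_neg (fun hc' => hc ((or_congr h0 h1).mp hc'))]
    ext
    simp only [Units.coe_map, MonoidHom.coe_coe, Units.val_neg, Units.val_one, map_neg, map_one]

/-- **`H¹(χ₁|_E) ∘ H¹(A⁻¹) = H¹(χ₁^{W⁄E})`** on `H¹(E, (W⁄E)[2])`: the transport of the Kummer class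
of `W⁄E` to `H¹(Γ_E, E[2](K̄)|_{Γ_E})` followed by the restricted character is the `T₁`-component of
`W⁄E`. [cite: SerreGaloisCohomology1997, I §2.4] -/
theorem resTwoTorsionCharH1_cohomologyMap_torsionTransferInvHom (h : W.toAffine.SplitTwoTorsion e₁ e₂ e₃)
    [(W.baseChange E).IsElliptic] (x : galH1Torsion (W.baseChange E) 2) :
    W.resTwoTorsionCharH1 E h
        (cohomologyMap (W.torsionTransferInvHom (E := E) (two_ne_zero : (2 : ℤ) ≠ 0)) 1 x) =
      (W.baseChange E).twoTorsionCharH1 (h.map E) x := by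
  obtain ⟨φ, rfl⟩ := oneCocycleClass_surjective _ x
  rw [twoTorsionCharH1_oneCocycleClass]
  change W.resTwoTorsionCharH1 E h (cohomologyMap (W.torsionTransferInvHom (E := E) two_ne_zero) 1
    (oneCocycleClass ((W.baseChange E).torsionGaloisModule 2).toTopRep φ)) = _
  rw [cohomologyMap_oneCocycleClass, resTwoTorsionCharH1_oneCocycleClass]
  congr 1
  apply Subtype.ext
  ext σ : 1
  rw [contOneCocycles.pullback_apply, contOneCocycles.pullback_apply, contOneCocycles.pullback_apply]
  change W.resTwoTorsionChar E h ((W.torsionTransferInvHom (E := E) two_ne_zero).hom (φ.1 σ)) =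
    (W.baseChange E).twoTorsionChar (h.map E) (φ.1 σ)
  rw [torsionTransferInvHom_apply]
  exact W.resTwoTorsionChar_torsionTransferEquiv_symm E h (φ.1 σ)


/-! ### The local Kummer image is the descent image -/

omit [CharZero K] [W.IsElliptic] [CharZero E] in
/-- The `2`-divisibility of `(W⁄E)(Ē)`, in the shape `kummerMapTorsion` takes.
[cite: SilvermanAEC2009, §VIII.2] -/
theorem two_zsmul_geomPoints_baseChange_surjective [(W.baseChange E).IsElliptic]
    (P : geomPoints (W.baseChange E)) : ∃ Q : geomPoints (W.baseChange E), (2 : ℤ) • Q = P :=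
  (W.baseChange E).zsmul_geomPoints_surjective_holds (two_ne_zero : (2 : ℤ) ≠ 0) P

/-- **The local Kummer image is the descent image of `E(K_v)`** (Silverman AEC X.1.4 at the
completion, on the tree's local Kummer condition): every class `c` of the local Kummer condition
`𝓛_E = kummerLocalConditionAt W 2 E ⊆ H¹(Γ_E, E[2](K̄)|_{Γ_E})` (the image of the local Kummer map
`E(E)/2 → H¹`, `range_localKummerMap`) has `T₁`-component, read in `Eˣ/Eˣ²` through the restricted
character and Kummer theory over `E`, equal to the descent component `x(P) - e₁` of some
`P ∈ (W⁄E)(E)` — namely the point with `localKummerMap P = c`.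
[cite: SilvermanAEC2009, Thm. X.1.1, Prop. X.1.4, X.§4 diagram (**)] -/
theorem exists_kummerEquiv_resTwoTorsionCharH1_eq_of_mem_kummerLocalConditionAt
    (h : W.toAffine.SplitTwoTorsion e₁ e₂ e₃) [(W.baseChange E).IsElliptic]
    {c : galoisCohomology (GaloisRep.restrictField E (W.torsionGaloisModule 2)) 1}
    (hc : c ∈ W.kummerLocalConditionAt 2 E) :
    ∃ P : (W.baseChange E).toAffine.Point,
      kummerEquiv E 2 (W.resTwoTorsionCharH1 E h c) =
        Additive.ofMul (Affine.Point.twoDescentComponent (W.baseChange E).toAffine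
          (algebraMap K E e₁) (algebraMap K E e₂) (algebraMap K E e₃) P) := by
  rw [← W.range_localKummerMap E (two_ne_zero : (2 : ℤ) ≠ 0), AddMonoidHom.mem_range] at hc
  obtain ⟨P, rfl⟩ := hc
  refine ⟨P, ?_⟩
  rw [W.localKummerMap_eq_cohomologyMap_kummerMapTorsion E (two_ne_zero : (2 : ℤ) ≠ 0)
      (W.two_zsmul_geomPoints_baseChange_surjective E) P,
    W.resTwoTorsionCharH1_cohomologyMap_torsionTransferInvHom E h,
    (W.baseChange E).kummerEquiv_twoTorsionCharH1_kummerMapTorsion (h.map E)]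

/-- **The `T₁`-component of a global class, localised**: for `c ∈ H¹(K, E[2])` whose restriction to
`Γ_E` lies in the local Kummer condition `𝓛_E` (e.g. `c ∈ Sel⁽²⁾(E/K)` and `E = K_v`,
`comap_res_kummerLocalConditionAt`), the image in `Eˣ/Eˣ²` of its global `T₁`-component
`kummerEquiv K 2 (H¹(χ₁) c) ∈ Kˣ/Kˣ²` is the descent component of a point `P ∈ E(E)`.
[cite: SilvermanAEC2009, Prop. X.1.4, X.§4 diagram (**)] -/
theorem exists_kummerEquiv_resMu_twoTorsionCharH1_eq_of_res_mem
    (h : W.toAffine.SplitTwoTorsion e₁ e₂ e₃) [(W.baseChange E).IsElliptic] {c : galH1Torsion W 2}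
    (hc : galoisCohomology.res (W.torsionGaloisModule 2) E 1 c ∈ W.kummerLocalConditionAt 2 E) :
    ∃ P : (W.baseChange E).toAffine.Point,
      kummerEquiv E 2 (resMu K E 2 (W.twoTorsionCharH1 h c)) =
        Additive.ofMul (Affine.Point.twoDescentComponent (W.baseChange E).toAffine
          (algebraMap K E e₁) (algebraMap K E e₂) (algebraMap K E e₃) P) := by
  obtain ⟨P, hP⟩ := W.exists_kummerEquiv_resTwoTorsionCharH1_eq_of_mem_kummerLocalConditionAt E h hc
  exact ⟨P, by rw [← resTwoTorsionCharH1_res, hP]⟩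

/-- **The same, on square classes**: writing the global `T₁`-component as the class of `a ∈ Kˣ`
(`kummerEquiv K 2 (H¹(χ₁) c) = [a]`), the class of `a` in `Eˣ/Eˣ²` is the descent component of a
point of `E(E)`. [cite: SilvermanAEC2009, Prop. X.1.4, X.§4 diagram (**)] -/
theorem exists_twoDescentComponent_eq_of_res_mem (h : W.toAffine.SplitTwoTorsion e₁ e₂ e₃)
    [(W.baseChange E).IsElliptic] {c : galH1Torsion W 2}
    (hc : galoisCohomology.res (W.torsionGaloisModule 2) E 1 c ∈ W.kummerLocalConditionAt 2 E)
    (a : Kˣ) (ha : kummerEquiv K 2 (W.twoTorsionCharH1 h c) = Additive.ofMul (QuotientGroup.mk a)) :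
    ∃ P : (W.baseChange E).toAffine.Point,
      Affine.Point.twoDescentComponent (W.baseChange E).toAffine
          (algebraMap K E e₁) (algebraMap K E e₂) (algebraMap K E e₃) P =
        QuotientGroup.mk (Units.map (algebraMap K E : K →* E) a) := by
  obtain ⟨P, hP⟩ := W.exists_kummerEquiv_resMu_twoTorsionCharH1_eq_of_res_mem E h hc
  refine ⟨P, ?_⟩
  have hc' : W.twoTorsionCharH1 h c = (kummerEquiv K 2).symm (Additive.ofMul (QuotientGroup.mk a)) := by
    rw [← ha, AddEquiv.symm_apply_apply]
  rw [hc', kummerEquiv_resMu_symm] at hP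
  exact Additive.ofMul.injective hP.symm


/-! ### Selmer classes over a number field -/

open NumberField

/-- **Selmer classes are locally descent classes**: for a number field `K`, a class
`c ∈ Sel⁽²⁾(E/K)` with global `T₁`-component `[a] ∈ Kˣ/Kˣ²` (`a ∈ Kˣ`), and a place `v` of `K`,
the class of `a` in `K_vˣ/K_vˣ²` is the descent component `x(P) - e₁` of a point `P ∈ E(K_v)`
(`Sel⁽²⁾ = ⋂_v loc_v⁻¹(𝓛_v)`, `mem_selmerGroup_iff_forall_localization_mem`).
[cite: SilvermanAEC2009, Prop. X.1.4, X.§4 (Prop. X.4.9)] -/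
theorem exists_twoDescentComponent_eq_of_mem_selmerGroup [NumberField K]
    (h : W.toAffine.SplitTwoTorsion e₁ e₂ e₃) {c : galH1Torsion W 2} (hc : c ∈ selmerGroup W 2)
    (v : Place K) [CharZero (Place.Completion v)] [(W.baseChange (Place.Completion v)).IsElliptic]
    (a : Kˣ) (ha : kummerEquiv K 2 (W.twoTorsionCharH1 h c) = Additive.ofMul (QuotientGroup.mk a)) :
    ∃ P : (W.baseChange (Place.Completion v)).toAffine.Point,
      Affine.Point.twoDescentComponent (W.baseChange (Place.Completion v)).toAffine
          (algebraMap K (Place.Completion v) e₁) (algebraMap K (Place.Completion v) e₂)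
          (algebraMap K (Place.Completion v) e₃) P =
        QuotientGroup.mk (Units.map (algebraMap K (Place.Completion v) : K →* Place.Completion v) a) := by
  have hv := (W.mem_selmerGroup_iff_forall_localization_mem 2 c).mp hc v
  exact W.exists_twoDescentComponent_eq_of_res_mem (Place.Completion v) h hv a ha

end WeierstrassCurve

end
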